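import Summits.AtomisticToContinuum.HydrodynamicLimit.Theorems.MourreKoopmanChargesStressStrongMixingTorusStatics
import Literature.MathematicalPhysics.KineticTheory.FluctuationSpace
import Mathlib.Analysis.Fourier.AddCircleMulti
import Mathlib.Topology.MetricSpace.Equicontinuity
import HarnessLib

/-!
# `StressStrongMixing` · line `birth`, stub B2glue `stub_torusStressIdentificationPosOfTrig`:
# the identification of the torus two-time stress moments on real Fourier monomials
# extends to all continuous test functions

Support file for the crux item stmt-AtomisticToContinuum-9584 (`StressStrongMixing`, route
`MourreKoopmanCharges` of `AtomisticToContinuum/HydrodynamicLimit`), proving the registered stub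
`stub_torusStressIdentificationPosOfTrig` (B2glue) of the skeleton `Cruxes/StressStrongMixing/Lines/birth.lean`.

The crux's two-time kinetic shear-stress moment `M_N(s; χ₁, χ₂) := (N+1)·E_{G_N}[Π(χ₁)(Φ_{s(N+1)^{-1/3}} z)·Π(χ₂)(z)]`,
`Π(χ)(z) = ∫ χ(y.1)(y.2 0 · y.2 1) d(empiricalMeasure z) = (N+1)⁻¹ Σᵢ χ(xᵢ) vᵢ⁰vᵢ¹`, under the canonical Gibbs law at rest
`G_N = localGibbsLaw σ 1 0 θ N (Φ N)`, is BILINEAR in `(χ₁, χ₂) ∈ C(𝕋³, ℝ)²` (the fields are finite averages,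
`stressField_eq_sum`, lying in `L²(G_N)` for `σ ≤ 1/2`, `memLp_and_integral_stressSum_mul_stressSum`, the time-shifted
one by invariance of `G_N` under the flow, `measurePreserving_flow_localGibbsLaw_const`) and UNIFORMLY BOUNDED,
`|M_N| ≤ θ²‖χ₁‖_∞‖χ₂‖_∞` (`abs_torusStressMoment_le`, `(∫χ²)^{1/2} ≤ ‖χ‖_∞` as `volume 𝕋³ = 1`); so is the limit
pairing `c·∫χ₁χ₂`.  Two pieces of pure functional analysis then give the stub with threshold `min σ₂ (1/2)`:

* `dense_span_realFourierMonomials`: the real span of the real Fourier monomials `x ↦ Re e_n(x)`, `x ↦ Im e_n(x)`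
  (`e_n = UnitAddTorus.mFourier n`) is dense in `C(𝕋³, ℝ)` — from Mathlib's complex density
  `UnitAddTorus.span_mFourier_closure_eq_top` (Stone–Weierstrass) by taking real parts;
* `tendsto_zero_of_bilinear_of_dense_span`: a uniformly bounded sequence of bilinear forms tending to `0` on `S × S`
  tends to `0` everywhere once `span S` is dense (equicontinuity + `EquicontinuousAt.tendsto_of_mem_closure`),
applied to `D_N := M_N(s; ·, ·) - c_F(s)∫(·)(·)`.

References: H. Spohn, *Large Scale Dynamics of Interacting Particles* (1991), Part I §7.1; Y. Katznelson,
*An Introduction to Harmonic Analysis* (2004), Ch. I §2 (density of trigonometric polynomials).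
-/

noncomputable section

open MeasureTheory ProbabilityTheory Filter Topology
open scoped InnerProductSpace ENNReal

namespace Summit.AtomisticToContinuum.HydrodynamicLimit.Theorems.MourreKoopmanChargesStressStrongMixing

open Literature.MathematicalPhysics.KineticTheory Literature.Analysis.FluidPDE

/-- Real and imaginary parts of a complex trigonometric polynomial lie in the real span of any set
`S ⊆ C(𝕋³, ℝ)` containing the real and imaginary parts of the monomials `e_n` (induction on the span:
`Re (cQ) = (Re c) Re Q - (Im c) Im Q`, `Im (cQ) = (Re c) Im Q + (Im c) Re Q`). [folklore] -/
theorem re_im_comp_mem_span {S : Set C(T3, ℝ)}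
    (hre : ∀ n : Fin 3 → ℤ, (⟨Complex.re, Complex.continuous_re⟩ : C(ℂ, ℝ)).comp (UnitAddTorus.mFourier n) ∈ S)
    (him : ∀ n : Fin 3 → ℤ, (⟨Complex.im, Complex.continuous_im⟩ : C(ℂ, ℝ)).comp (UnitAddTorus.mFourier n) ∈ S)
    {Q : C(T3, ℂ)} (hQ : Q ∈ Submodule.span ℂ (Set.range (UnitAddTorus.mFourier (d := Fin 3)))) :
    (⟨Complex.re, Complex.continuous_re⟩ : C(ℂ, ℝ)).comp Q ∈ Submodule.span ℝ S ∧
      (⟨Complex.im, Complex.continuous_im⟩ : C(ℂ, ℝ)).comp Q ∈ Submodule.span ℝ S := by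
  set re : C(ℂ, ℝ) := ⟨Complex.re, Complex.continuous_re⟩ with hre_def
  set im : C(ℂ, ℝ) := ⟨Complex.im, Complex.continuous_im⟩ with him_def
  induction hQ using Submodule.span_induction with
  | mem Q hQ =>
    obtain ⟨n, rfl⟩ := hQ
    exact ⟨Submodule.subset_span (hre n), Submodule.subset_span (him n)⟩
  | zero =>
    have h1 : re.comp (0 : C(T3, ℂ)) = 0 := by ext x; simp [hre_def]
    have h2 : im.comp (0 : C(T3, ℂ)) = 0 := by ext x; simp [him_def]
    rw [h1, h2]
    exact ⟨zero_mem _, zero_mem _⟩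
  | add Q Q' _ _ ih ih' =>
    have h1 : re.comp (Q + Q') = re.comp Q + re.comp Q' := by ext x; simp [hre_def]
    have h2 : im.comp (Q + Q') = im.comp Q + im.comp Q' := by ext x; simp [him_def]
    rw [h1, h2]
    exact ⟨add_mem ih.1 ih'.1, add_mem ih.2 ih'.2⟩
  | smul c Q _ ih =>
    have h1 : re.comp (c • Q) = c.re • re.comp Q - c.im • im.comp Q := by
      ext x; simp [hre_def, him_def, Complex.mul_re]
    have h2 : im.comp (c • Q) = c.re • im.comp Q + c.im • re.comp Q := by
      ext x; simp [hre_def, him_def, Complex.mul_im]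
    rw [h1, h2]
    exact ⟨sub_mem (Submodule.smul_mem _ _ ih.1) (Submodule.smul_mem _ _ ih.2),
      add_mem (Submodule.smul_mem _ _ ih.2) (Submodule.smul_mem _ _ ih.1)⟩

/-- **Density of real trigonometric polynomials in `C(𝕋³, ℝ)`**: the real span of the continuous functions
whose underlying map is a real Fourier monomial `x ↦ Re e_n(x)` or `x ↦ Im e_n(x)` is dense — lift `g` to
`C(𝕋³, ℂ)`, approximate it by complex trigonometric polynomials (`UnitAddTorus.span_mFourier_closure_eq_top`)
and take real parts (post-composition with `Re` is continuous; `re_im_comp_mem_span`). [folklore] -/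
theorem dense_span_realFourierMonomials :
    Dense ((Submodule.span ℝ {g : C(T3, ℝ) | ∃ n : Fin 3 → ℤ,
      (g : T3 → ℝ) ∈ ({fun x : T3 => (UnitAddTorus.mFourier n x).re,
        fun x : T3 => (UnitAddTorus.mFourier n x).im} : Set (T3 → ℝ))} : Submodule ℝ C(T3, ℝ)) :
      Set C(T3, ℝ)) := by
  set S : Set C(T3, ℝ) := {g : C(T3, ℝ) | ∃ n : Fin 3 → ℤ,
      (g : T3 → ℝ) ∈ ({fun x : T3 => (UnitAddTorus.mFourier n x).re,
        fun x : T3 => (UnitAddTorus.mFourier n x).im} : Set (T3 → ℝ))} with hS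
  set re : C(ℂ, ℝ) := ⟨Complex.re, Complex.continuous_re⟩ with hre_def
  have hre : ∀ n : Fin 3 → ℤ, re.comp (UnitAddTorus.mFourier n) ∈ S := fun n => ⟨n, Or.inl rfl⟩
  have him : ∀ n : Fin 3 → ℤ,
      (⟨Complex.im, Complex.continuous_im⟩ : C(ℂ, ℝ)).comp (UnitAddTorus.mFourier n) ∈ S :=
    fun n => ⟨n, Or.inr rfl⟩
  have hsub : re.comp '' (Submodule.span ℂ (Set.range (UnitAddTorus.mFourier (d := Fin 3))) : Set C(T3, ℂ)) ⊆
      (Submodule.span ℝ S : Set C(T3, ℝ)) := by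
    rintro _ ⟨Q, hQ, rfl⟩
    exact (re_im_comp_mem_span hre him hQ).1
  intro g
  have hG : (⟨((↑) : ℝ → ℂ), Complex.continuous_ofReal⟩ : C(ℝ, ℂ)).comp g ∈
      closure (Submodule.span ℂ (Set.range (UnitAddTorus.mFourier (d := Fin 3))) : Set C(T3, ℂ)) := by
    rw [← Submodule.topologicalClosure_coe, UnitAddTorus.span_mFourier_closure_eq_top]
    exact Submodule.mem_top
  have h1 := image_closure_subset_closure_image (ContinuousMap.continuous_postcomp re)
    (Set.mem_image_of_mem re.comp hG)
  have h2 : re.comp ((⟨((↑) : ℝ → ℂ), Complex.continuous_ofReal⟩ : C(ℝ, ℂ)).comp g) = g := by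
    ext x
    simp [hre_def]
  rw [h2] at h1
  exact closure_mono hsub h1

/-- **Extension of limits of uniformly bounded bilinear forms.**  Let `D_N : E → E → ℝ` be additive and
homogeneous in each slot, uniformly bounded (`|D_N g h| ≤ K‖g‖‖h‖`), and suppose `D_N g h → 0` for all `g, h`
in a set `S` whose real span is dense in the normed space `E`.  Then `D_N g h → 0` for all `g, h : E`:
by bilinearity the convergence holds on `span S × span S`, the uniform bound makes `(N ↦ D_N)` equicontinuous
at every point of `E × E`, and an equicontinuous family converging on a dense set converges everywhere
(`EquicontinuousAt.tendsto_of_mem_closure`). [folklore] -/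
theorem tendsto_zero_of_bilinear_of_dense_span {E : Type*} [NormedAddCommGroup E] [NormedSpace ℝ E]
    {S : Set E} (hS : Dense ((Submodule.span ℝ S : Submodule ℝ E) : Set E)) {D : ℕ → E → E → ℝ}
    (hadd₁ : ∀ N g g' h, D N (g + g') h = D N g h + D N g' h)
    (hsmul₁ : ∀ N (a : ℝ) g h, D N (a • g) h = a * D N g h)
    (hadd₂ : ∀ N g h h', D N g (h + h') = D N g h + D N g h')
    (hsmul₂ : ∀ N (a : ℝ) g h, D N g (a • h) = a * D N g h)
    {K : ℝ} (hK : ∀ N g h, |D N g h| ≤ K * ‖g‖ * ‖h‖)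
    (hlim : ∀ g ∈ S, ∀ h ∈ S, Tendsto (fun N => D N g h) atTop (𝓝 0)) (g h : E) :
    Tendsto (fun N => D N g h) atTop (𝓝 0) := by
  -- Step 1: convergence on `span S × span S`
  have hzero₁ : ∀ N h, D N 0 h = 0 := fun N h => by simpa using hsmul₁ N 0 0 h
  have hzero₂ : ∀ N g, D N g 0 = 0 := fun N g => by simpa using hsmul₂ N 0 g 0
  have hS₁ : ∀ g ∈ S, ∀ h ∈ Submodule.span ℝ S, Tendsto (fun N => D N g h) atTop (𝓝 0) := by
    intro g hg h hh
    induction hh using Submodule.span_induction with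
    | mem h hh => exact hlim g hg h hh
    | zero => simp only [hzero₂]; exact tendsto_const_nhds
    | add h h' _ _ ih ih' => simp only [hadd₂]; simpa using ih.add ih'
    | smul a h _ ih => simp only [hsmul₂]; simpa using ih.const_mul a
  have hspan : ∀ g ∈ Submodule.span ℝ S, ∀ h ∈ Submodule.span ℝ S,
      Tendsto (fun N => D N g h) atTop (𝓝 0) := by
    intro g hg
    induction hg using Submodule.span_induction with
    | mem g hg => exact hS₁ g hg
    | zero => intro h _; simp only [hzero₁]; exact tendsto_const_nhds
    | add g g' _ _ ih ih' => intro h hh; simp only [hadd₁]; simpa using (ih h hh).add (ih' h hh)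
    | smul a g _ ih => intro h hh; simp only [hsmul₁]; simpa using (ih h hh).const_mul a
  -- Step 2: equicontinuity of `N ↦ ((g, h) ↦ D_N g h)` at `(g, h)` (with the positive constant `L = |K| + 1`)
  set L : ℝ := |K| + 1 with hLdef
  have hL : 0 < L := by positivity
  have hKL : ∀ N g h, |D N g h| ≤ L * ‖g‖ * ‖h‖ := by
    intro N g h
    have h0 : K * (‖g‖ * ‖h‖) ≤ L * (‖g‖ * ‖h‖) :=
      mul_le_mul_of_nonneg_right ((le_abs_self K).trans (lt_add_one _).le) (by positivity)
    linarith [hK N g h]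
  have hequi : EquicontinuousAt (fun (N : ℕ) (p : E × E) => D N p.1 p.2) (g, h) := by
    rw [Metric.equicontinuousAt_iff]
    intro ε hε
    set R : ℝ := ‖g‖ + ‖h‖ + 1 with hRdef
    have hR : 0 < R := by positivity
    refine ⟨min 1 (ε / (2 * L * R)), lt_min one_pos (by positivity), fun p hp N => ?_⟩
    rw [Prod.dist_eq, max_lt_iff, dist_eq_norm, dist_eq_norm] at hp
    have hp1 : ‖p.1 - g‖ ≤ ε / (2 * L * R) := (hp.1.trans_le (min_le_right _ _)).le
    have hp2 : ‖p.2 - h‖ ≤ ε / (2 * L * R) := (hp.2.trans_le (min_le_right _ _)).le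
    have hp2' : ‖p.2‖ ≤ ‖h‖ + 1 := by
      have := norm_le_norm_add_norm_sub' p.2 h
      linarith [(hp.2.trans_le (min_le_left _ _)).le]
    have e1 := hadd₁ N (p.1 - g) g p.2
    have e2 := hadd₂ N g (p.2 - h) h
    rw [sub_add_cancel] at e1 e2
    have key : D N g h - D N p.1 p.2 = -(D N (p.1 - g) p.2 + D N g (p.2 - h)) := by
      rw [e1, e2]; ring
    rw [Real.dist_eq, key, abs_neg]
    have hδ : 0 ≤ ε / (2 * L * R) := by positivity
    calc |D N (p.1 - g) p.2 + D N g (p.2 - h)|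
        ≤ |D N (p.1 - g) p.2| + |D N g (p.2 - h)| := abs_add_le _ _
      _ ≤ L * ‖p.1 - g‖ * ‖p.2‖ + L * ‖g‖ * ‖p.2 - h‖ := add_le_add (hKL _ _ _) (hKL _ _ _)
      _ ≤ L * (ε / (2 * L * R)) * (‖h‖ + 1) + L * ‖g‖ * (ε / (2 * L * R)) := by gcongr
      _ = ε / 2 := by rw [hRdef]; field_simp; ring
      _ < ε := half_lt_self hε
  -- Step 3: `(g, h)` is in the closure of `span S × span S`, where the family converges to `0`
  have hclos : (g, h) ∈ closure (((Submodule.span ℝ S : Submodule ℝ E) : Set E) ×ˢ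
      ((Submodule.span ℝ S : Submodule ℝ E) : Set E)) := by
    rw [closure_prod_eq, hS.closure_eq]
    exact Set.mem_prod.2 ⟨Set.mem_univ _, Set.mem_univ _⟩
  exact hequi.tendsto_of_mem_closure (f := fun _ => (0 : ℝ)) (l := atTop) tendsto_const_nhds
    (fun p hp => hspan p.1 hp.1 p.2 hp.2) hclos

/-! ### The empirical stress field: linearity in the test function, `L²` bounds -/

/-- `Π(g + g') = Π(g) + Π(g')` pointwise (finite averages, `stressField_eq_sum`). [folklore] -/
theorem stressField_add {n : ℕ} (g g' : C(T3, ℝ)) (z : Config n (Fin 3) T3) :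
    ∫ y, (g + g') y.1 * (y.2 0 * y.2 1) ∂(empiricalMeasure z) =
      (∫ y, g y.1 * (y.2 0 * y.2 1) ∂(empiricalMeasure z)) + ∫ y, g' y.1 * (y.2 0 * y.2 1) ∂(empiricalMeasure z) := by
  rw [stressField_eq_sum ((g + g' : C(T3, ℝ)) : T3 → ℝ) z, stressField_eq_sum g z, stressField_eq_sum g' z, ← mul_add,
    ← Finset.sum_add_distrib]
  congr 1
  refine Finset.sum_congr rfl fun i _ => ?_
  rw [ContinuousMap.add_apply]
  ring

/-- `Π(a • g) = a Π(g)` pointwise (finite averages, `stressField_eq_sum`). [folklore] -/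
theorem stressField_smul {n : ℕ} (a : ℝ) (g : C(T3, ℝ)) (z : Config n (Fin 3) T3) :
    ∫ y, (a • g) y.1 * (y.2 0 * y.2 1) ∂(empiricalMeasure z) =
      a * ∫ y, g y.1 * (y.2 0 * y.2 1) ∂(empiricalMeasure z) := by
  rw [stressField_eq_sum ((a • g : C(T3, ℝ)) : T3 → ℝ) z, stressField_eq_sum g z]
  simp only [Finset.mul_sum]
  refine Finset.sum_congr rfl fun i _ => ?_
  rw [ContinuousMap.smul_apply, smul_eq_mul]
  ring

/-- The empirical stress field of a continuous test function is in `L²(G_N)` for `σ ≤ 1/2`, `θ > 0`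
(as in the proof of `abs_torusStressMoment_le`). [folklore] -/
theorem memLp_stressField {σ θ : ℝ} (hσ : σ ≤ 1 / 2) (hθ : 0 < θ) (N : ℕ)
    (Φ : HardSphereFlow (Torus.geometry (Fin 3)) (hsDiameter σ N) (N + 1)) (g : C(T3, ℝ)) :
    MemLp (fun z : Config (N + 1) (Fin 3) T3 => ∫ y, g y.1 * (y.2 0 * y.2 1) ∂(empiricalMeasure z)) 2
      (localGibbsLaw σ (fun _ => 1) (fun _ => 0) (fun _ => θ) N Φ) := by
  -- adapted from `abs_torusStressMoment_le` (`hfield`)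
  have h := ((memLp_and_integral_stressSum_mul_stressSum hσ hθ N Φ g.continuous g.continuous).1).const_mul
    (((N + 1 : ℕ) : ℝ))⁻¹
  refine h.congr_norm (measurable_stressField g.continuous).aestronglyMeasurable
    (Eventually.of_forall fun z => ?_)
  rw [stressField_eq_sum g z]

/-- The two-time product `Π(g)(Φ_t z) · Π(h)(z)` is `G_N`-integrable for `σ ≤ 1/2`, `θ > 0` (both factors are in
`L²(G_N)`, the shifted one by invariance of `G_N` under the flow). [folklore] -/
theorem integrable_stressField_flow_mul {σ θ : ℝ} (hσ : σ ≤ 1 / 2) (hθ : 0 < θ) (N : ℕ)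
    (Φ : HardSphereFlow (Torus.geometry (Fin 3)) (hsDiameter σ N) (N + 1)) (g h : C(T3, ℝ)) (t : ℝ) :
    Integrable (fun z : Config (N + 1) (Fin 3) T3 =>
      (∫ y, g y.1 * (y.2 0 * y.2 1) ∂(empiricalMeasure (Φ.flow t z))) *
        (∫ y, h y.1 * (y.2 0 * y.2 1) ∂(empiricalMeasure z)))
      (localGibbsLaw σ (fun _ => 1) (fun _ => 0) (fun _ => θ) N Φ) :=
  ((memLp_stressField hσ hθ N Φ g).comp_measurePreserving
      (measurePreserving_flow_localGibbsLaw_const σ 1 θ 0 N Φ t)).integrable_mul (memLp_stressField hσ hθ N Φ h)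

/-- `(∫ g²)^{1/2} ≤ ‖g‖_∞` on the probability space `𝕋³`. [folklore] -/
theorem sqrt_integral_sq_le_norm (g : C(T3, ℝ)) : Real.sqrt (∫ x, g x ^ 2) ≤ ‖g‖ := by
  have h1 : ∫ x, g x ^ 2 ≤ ‖g‖ ^ 2 := by
    have h := norm_integral_le_of_norm_le_const (μ := (volume : Measure T3)) (f := fun x => g x ^ 2)
      (C := ‖g‖ ^ 2) (Eventually.of_forall fun x => by
        rw [norm_pow]
        exact pow_le_pow_left₀ (norm_nonneg _) (g.norm_coe_le_norm x) 2)
    rw [probReal_univ, mul_one, Real.norm_eq_abs] at h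
    exact (le_abs_self _).trans h
  calc Real.sqrt (∫ x, g x ^ 2) ≤ Real.sqrt (‖g‖ ^ 2) := Real.sqrt_le_sqrt h1
    _ = ‖g‖ := Real.sqrt_sq (norm_nonneg _)

/-- **Uniform sup-norm bound on the two-time stress moment**: for `σ ≤ 1/2`, `θ > 0`, every flow family,
`g, h ∈ C(𝕋³, ℝ)`, every real time and every `N`, `|(N+1)·E_{G_N}[Π(g)(Φ_t z)·Π(h)(z)]| ≤ θ²‖g‖_∞‖h‖_∞`
(`abs_torusStressMoment_le` and `sqrt_integral_sq_le_norm`). [folklore] -/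
theorem abs_torusStressMoment_le_norm {σ θ : ℝ} (hσ : σ ≤ 1 / 2) (hθ : 0 < θ)
    (Φ : (N : ℕ) → HardSphereFlow (Torus.geometry (Fin 3)) (hsDiameter σ N) (N + 1)) (g h : C(T3, ℝ))
    (t : ℝ) (N : ℕ) :
    |((N : ℝ) + 1) * ∫ z, (∫ y, g y.1 * (y.2 0 * y.2 1) ∂(empiricalMeasure ((Φ N).flow t z))) *
        (∫ y, h y.1 * (y.2 0 * y.2 1) ∂(empiricalMeasure z))
        ∂(localGibbsLaw σ (fun _ => 1) (fun _ => 0) (fun _ => θ) N (Φ N))| ≤ θ ^ 2 * ‖g‖ * ‖h‖ := by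
  refine (abs_torusStressMoment_le σ hσ θ hθ Φ g h g.continuous h.continuous t N).trans ?_
  have hθ2 : 0 ≤ θ ^ 2 := sq_nonneg θ
  have hg := sqrt_integral_sq_le_norm g
  have hh := sqrt_integral_sq_le_norm h
  gcongr

/-- `|∫ g h| ≤ ‖g‖_∞ ‖h‖_∞` on the probability space `𝕋³`. [folklore] -/
theorem abs_integral_mul_le_norm (g h : C(T3, ℝ)) : |∫ x, g x * h x| ≤ ‖g‖ * ‖h‖ := by
  have h1 := norm_integral_le_of_norm_le_const (μ := (volume : Measure T3)) (f := fun x => g x * h x)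
    (C := ‖g‖ * ‖h‖) (Eventually.of_forall fun x => by
      rw [norm_mul]
      exact mul_le_mul (g.norm_coe_le_norm x) (h.norm_coe_le_norm x) (norm_nonneg _) (norm_nonneg _))
  rwa [probReal_univ, mul_one, Real.norm_eq_abs] at h1

/-- `∫ (g + g') h = ∫ g h + ∫ g' h` for continuous functions on `𝕋³`. [folklore] -/
theorem integral_mul_add_left (g g' h : C(T3, ℝ)) :
    ∫ x, (g + g') x * h x = (∫ x, g x * h x) + ∫ x, g' x * h x := by
  simp only [ContinuousMap.add_apply, add_mul]
  exact integral_add (integrable_of_continuous_T3 (by fun_prop)) (integrable_of_continuous_T3 (by fun_prop))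

/-- `∫ g (h + h') = ∫ g h + ∫ g h'` for continuous functions on `𝕋³`. [folklore] -/
theorem integral_mul_add_right (g h h' : C(T3, ℝ)) :
    ∫ x, g x * (h + h') x = (∫ x, g x * h x) + ∫ x, g x * h' x := by
  simp only [ContinuousMap.add_apply, mul_add]
  exact integral_add (integrable_of_continuous_T3 (by fun_prop)) (integrable_of_continuous_T3 (by fun_prop))

/-- `∫ (a g) h = a ∫ g h`. [folklore] -/
theorem integral_smul_mul_left (a : ℝ) (g h : C(T3, ℝ)) : ∫ x, (a • g) x * h x = a * ∫ x, g x * h x := by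
  simp only [ContinuousMap.smul_apply, smul_eq_mul, mul_assoc]
  exact integral_const_mul a _

/-- `∫ g (a h) = a ∫ g h`. [folklore] -/
theorem integral_mul_smul_right (a : ℝ) (g h : C(T3, ℝ)) : ∫ x, g x * (a • h) x = a * ∫ x, g x * h x := by
  simp only [ContinuousMap.smul_apply, smul_eq_mul, mul_left_comm _ a]
  exact integral_const_mul a _

/-- **STUB B2glue `stub_torusStressIdentificationPosOfTrig`** of the line `birth` of crux stmt-AtomisticToContinuum-9584
(`= TorusStressIdentificationPosOfTrig` of the skeleton, expanded): if, below a threshold `σ₂`, the torus two-time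
stress moments `M_N(s; χ₁, χ₂)` converge to `c_F(s)·∫χ₁χ₂` for all REAL FOURIER MONOMIALS `χ₁ ∈ {Re e_n, Im e_n}`,
`χ₂ ∈ {Re e_m, Im e_m}` (every density-one framework `F`, flow family, `s > 0`), then below `min σ₂ (1/2)` they
converge for ALL continuous `χ₁, χ₂`: `D_N := M_N(s; ·, ·) - c_F(s)∫(·)(·)` is a sequence of bilinear forms on
`C(𝕋³, ℝ)` (`stressField_add/smul`, `integrable_stressField_flow_mul`) with the uniform bound
`(θ² + |c_F(s)|)‖χ₁‖_∞‖χ₂‖_∞` (`abs_torusStressMoment_le_norm`, `abs_integral_mul_le_norm`) tending to zero on the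
real Fourier monomials, whose span is dense (`dense_span_realFourierMonomials`), hence tending to zero everywhere
(`tendsto_zero_of_bilinear_of_dense_span`). [folklore] -/
theorem stub_torusStressIdentificationPosOfTrig :
    (∃ σ₂ : ℝ, 0 < σ₂ ∧ ∀ σ : ℝ, 0 < σ → σ < σ₂ → ∀ θ : ℝ, 0 < θ → ∀ z : ℝ, 0 < z →
      ∀ F : HardSphereFluctuationData σ,
        (IsHardSphereGibbs σ z θ⁻¹ (0 : V3) F.μ ∧
          (∫ ω, cellCharge 0 ω ∂F.μ = 1) ∧
          (∃ Φ : InfiniteHardSphereFlow (Fin 3) σ, Φ.IsEquilibriumFlow ∧ ∀ t : ℝ, F.flow t =ᵐ[F.μ] Φ.flow t) ∧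
          cellObs (fun v : V3 => v 0 * v 1) ∈ F.localObs) →
        ∀ Φ : (N : ℕ) → HardSphereFlow (Torus.geometry (Fin 3)) (hsDiameter σ N) (N + 1),
        ∀ n m : Fin 3 → ℤ,
        ∀ χ₁ ∈ ({fun x : T3 => (UnitAddTorus.mFourier n x).re, fun x : T3 => (UnitAddTorus.mFourier n x).im} : Set (T3 → ℝ)),
        ∀ χ₂ ∈ ({fun x : T3 => (UnitAddTorus.mFourier m x).re, fun x : T3 => (UnitAddTorus.mFourier m x).im} : Set (T3 → ℝ)),
        ∀ s : ℝ, 0 < s →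
          Tendsto (fun N : ℕ => ((N : ℝ) + 1) * ∫ z, (∫ y, χ₁ y.1 * (y.2 0 * y.2 1)
              ∂(empiricalMeasure ((Φ N).flow (s * ((N : ℝ) + 1) ^ (-(1 / 3 : ℝ))) z))) *
            (∫ y, χ₂ y.1 * (y.2 0 * y.2 1) ∂(empiricalMeasure z))
            ∂(localGibbsLaw σ (fun _ => 1) (fun _ => 0) (fun _ => θ) N (Φ N))) atTop
            (𝓝 (⟪F.koopman s (F.fluct (cellObs fun v : V3 => v 0 * v 1)),
                  F.fluct (cellObs fun v : V3 => v 0 * v 1)⟫_ℝ * ∫ x, χ₁ x * χ₂ x))) →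
    ∃ σ₂ : ℝ, 0 < σ₂ ∧ ∀ σ : ℝ, 0 < σ → σ < σ₂ → ∀ θ : ℝ, 0 < θ → ∀ z : ℝ, 0 < z →
      ∀ F : HardSphereFluctuationData σ,
        (IsHardSphereGibbs σ z θ⁻¹ (0 : V3) F.μ ∧
          (∫ ω, cellCharge 0 ω ∂F.μ = 1) ∧
          (∃ Φ : InfiniteHardSphereFlow (Fin 3) σ, Φ.IsEquilibriumFlow ∧ ∀ t : ℝ, F.flow t =ᵐ[F.μ] Φ.flow t) ∧
          cellObs (fun v : V3 => v 0 * v 1) ∈ F.localObs) →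
        ∀ Φ : (N : ℕ) → HardSphereFlow (Torus.geometry (Fin 3)) (hsDiameter σ N) (N + 1),
        ∀ χ₁ χ₂ : T3 → ℝ, Continuous χ₁ → Continuous χ₂ → ∀ s : ℝ, 0 < s →
          Tendsto (fun N : ℕ => ((N : ℝ) + 1) * ∫ z, (∫ y, χ₁ y.1 * (y.2 0 * y.2 1)
              ∂(empiricalMeasure ((Φ N).flow (s * ((N : ℝ) + 1) ^ (-(1 / 3 : ℝ))) z))) *
            (∫ y, χ₂ y.1 * (y.2 0 * y.2 1) ∂(empiricalMeasure z))
            ∂(localGibbsLaw σ (fun _ => 1) (fun _ => 0) (fun _ => θ) N (Φ N))) atTop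
            (𝓝 (⟪F.koopman s (F.fluct (cellObs fun v : V3 => v 0 * v 1)),
                  F.fluct (cellObs fun v : V3 => v 0 * v 1)⟫_ℝ * ∫ x, χ₁ x * χ₂ x)) := by
  rintro ⟨σ₂, hσ₂, H⟩
  refine ⟨min σ₂ (1 / 2), lt_min hσ₂ one_half_pos, ?_⟩
  intro σ hσ hσlt θ hθ z hz F hF Φ χ₁ χ₂ hχ₁ hχ₂ s hs
  have hσ2 : σ ≤ 1 / 2 := (hσlt.trans_le (min_le_right _ _)).le
  have HF := H σ hσ (hσlt.trans_le (min_le_left _ _)) θ hθ z hz F hF Φ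
  set c : ℝ := ⟪F.koopman s (F.fluct (cellObs fun v : V3 => v 0 * v 1)),
    F.fluct (cellObs fun v : V3 => v 0 * v 1)⟫_ℝ with hc
  -- `D_N g h := M_N(s; g, h) - c ∫ g h → 0` for all `g, h ∈ C(𝕋³, ℝ)`, applied to `g = χ₁`, `h = χ₂`
  have hmain : Tendsto (fun N : ℕ => ((N : ℝ) + 1) * ∫ z, (∫ y, (⟨χ₁, hχ₁⟩ : C(T3, ℝ)) y.1 * (y.2 0 * y.2 1)
        ∂(empiricalMeasure ((Φ N).flow (s * ((N : ℝ) + 1) ^ (-(1 / 3 : ℝ))) z))) *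
      (∫ y, (⟨χ₂, hχ₂⟩ : C(T3, ℝ)) y.1 * (y.2 0 * y.2 1) ∂(empiricalMeasure z))
      ∂(localGibbsLaw σ (fun _ => 1) (fun _ => 0) (fun _ => θ) N (Φ N)) -
      c * ∫ x, (⟨χ₁, hχ₁⟩ : C(T3, ℝ)) x * (⟨χ₂, hχ₂⟩ : C(T3, ℝ)) x) atTop (𝓝 0) := by
    refine tendsto_zero_of_bilinear_of_dense_span dense_span_realFourierMonomials
      (D := fun (N : ℕ) (g h : C(T3, ℝ)) => ((N : ℝ) + 1) * ∫ z, (∫ y, g y.1 * (y.2 0 * y.2 1)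
          ∂(empiricalMeasure ((Φ N).flow (s * ((N : ℝ) + 1) ^ (-(1 / 3 : ℝ))) z))) *
        (∫ y, h y.1 * (y.2 0 * y.2 1) ∂(empiricalMeasure z))
        ∂(localGibbsLaw σ (fun _ => 1) (fun _ => 0) (fun _ => θ) N (Φ N)) - c * ∫ x, g x * h x)
      (K := θ ^ 2 + |c|) ?_ ?_ ?_ ?_ ?_ ?_ _ _
    · -- additivity in `g`
      intro N g g' h
      have hI := integrable_stressField_flow_mul hσ2 hθ N (Φ N) g h (s * ((N : ℝ) + 1) ^ (-(1 / 3 : ℝ)))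
      have hI' := integrable_stressField_flow_mul hσ2 hθ N (Φ N) g' h (s * ((N : ℝ) + 1) ^ (-(1 / 3 : ℝ)))
      simp only [stressField_add, add_mul]
      rw [integral_add hI hI', integral_mul_add_left]
      ring
    · -- homogeneity in `g`
      intro N a g h
      simp only [stressField_smul, mul_assoc, integral_const_mul, integral_smul_mul_left]
      ring
    · -- additivity in `h`
      intro N g h h'
      have hI := integrable_stressField_flow_mul hσ2 hθ N (Φ N) g h (s * ((N : ℝ) + 1) ^ (-(1 / 3 : ℝ)))
      have hI' := integrable_stressField_flow_mul hσ2 hθ N (Φ N) g h' (s * ((N : ℝ) + 1) ^ (-(1 / 3 : ℝ)))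
      simp only [stressField_add, mul_add]
      rw [integral_add hI hI', integral_mul_add_right]
      ring
    · -- homogeneity in `h`
      intro N a g h
      simp only [stressField_smul, mul_left_comm _ a, integral_const_mul, integral_mul_smul_right]
      ring
    · -- the uniform bound
      intro N g h
      calc _ ≤ |((N : ℝ) + 1) * ∫ z, (∫ y, g y.1 * (y.2 0 * y.2 1)
              ∂(empiricalMeasure ((Φ N).flow (s * ((N : ℝ) + 1) ^ (-(1 / 3 : ℝ))) z))) *
            (∫ y, h y.1 * (y.2 0 * y.2 1) ∂(empiricalMeasure z))
            ∂(localGibbsLaw σ (fun _ => 1) (fun _ => 0) (fun _ => θ) N (Φ N))| + |c * ∫ x, g x * h x| :=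
            abs_sub _ _
        _ ≤ θ ^ 2 * ‖g‖ * ‖h‖ + |c| * (‖g‖ * ‖h‖) := by
            refine add_le_add (abs_torusStressMoment_le_norm hσ2 hθ Φ g h _ N) ?_
            rw [abs_mul]
            exact mul_le_mul_of_nonneg_left (abs_integral_mul_le_norm g h) (abs_nonneg c)
        _ = (θ ^ 2 + |c|) * ‖g‖ * ‖h‖ := by ring
    · -- convergence on the real Fourier monomials: the hypothesis
      intro g hg h hh
      obtain ⟨n, hn⟩ := hg
      obtain ⟨m, hm⟩ := hh
      exact tendsto_sub_nhds_zero_iff.2 (HF n m g hn h hm s hs)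
  exact tendsto_sub_nhds_zero_iff.1 hmain

end Summit.AtomisticToContinuum.HydrodynamicLimit.Theorems.MourreKoopmanChargesStressStrongMixing

end
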